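import Summits.AtomisticToContinuum.BoseEinsteinCondensation.Theorems.BECHeatBathGapSquareSummableInfluenceMayersAlignment
import Summits.AtomisticToContinuum.BoseEinsteinCondensation.Theorems.BECHeatBathGapSquareSummableInfluenceExistence
import Summits.AtomisticToContinuum.BoseEinsteinCondensation.Theorems.BECHeatBathGapSquareSummableInfluenceStubGroundStateApprox
import HarnessLib

/-!
# Route `BECHeatBathGap`, crux `SquareSummableInfluence` (stmt-AtomisticToContinuum-14368), line `registered`:
# the MAYERS JUNCTION — one bath particle's influence + alignment of the conditional amplitudes ⇒ condensation

Supports (does not close) stmt-AtomisticToContinuum-14368 (lead c6). The route reaches its intermediate node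
`SomeNearMinimiserCondenses` (stmt-14369) through `ParticleTensorisation ∧ SquareSummableInfluence` (A1 ∧ A2,
`TensorisedIncrement`). This file lands the ALTERNATIVE junction opened by the intrinsic Mayers bound
(`occupation_ge_alignment_sub_leastSquares`, this line): condensation of some near-minimiser follows from

* `SingleParticleInfluence` (hypothesis `hSI`, spelled out): at low density, for every `ε > 0`, eventually in `N`,
  every `N`-body Dirichlet ground state `Θ₀` in the box of side `((N+1)/ρ)^{1/3}` admits an `(N+1)`-body ground state `Ψ₀`
  whose least-squares influence of EACH single bath particle is `≤ ε` — A2 (card A2 sums over the `N` bath labels and asks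
  `≤ ε`; by Bose symmetry its summands are equal, so A2 at ONE tolerance gives this at every `ε`), and, by lead c4's energy
  ceiling, also a consequence of a one-particle conditional Poincaré inequality for `|Θ₀|²`;
* `ConditionalAmplitudeAlignment` (hypothesis `hAL`, spelled out, division-free): at low density there is `c₀ > 0` with,
  eventually in `N`, for all such ground states `Θ₀, Ψ₀`: some normalised mode `u` and some test weight `κ ≤ 1` on bath
  configurations dominated by the squared overlap of `u` with the NORMALISED conditional one-particle amplitude of `Θ₀`
  (`κ(X)·∫_Λ|Θ₀(X^{i→a})|²da ≤ |∫_Λ conj u · Θ₀(X^{i→·})|²`) have `∫_{Λ^{N+1}} |Ψ₀|² κ(tail) ≥ c₀` — Mayers' condensate functional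
  `E_{|Ψ₀|²}|⟨u, θ̂_X̂⟩|² ≥ c₀`;

namely `someNearMinimiserCondenses_of_singleInfluence_of_alignment : hSI → hAL → SomeNearMinimiserCondenses` with
`c = c₀/16` (tolerances `ε = η = c₀/16`; the ground state `Ψ₀` is transferred to near-minimising trial states by
`stub_groundStateApprox` and the `√occ`-Lipschitz lemma). No tensorisation / heat-bath gap is used.
`[folklore]` bookkeeping + [cite: Mayers2001] for the reading; [cite: PenroseOnsager1956] for the criterion.
-/

noncomputable section

open MeasureTheory Filter Function
open scoped ENNReal NNReal Topology ComplexConjugate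

namespace Summit.AtomisticToContinuum.BoseEinsteinCondensation.Theorems.SquareSummableInfluence

open Literature.MathematicalPhysics.QuantumManyBody.BoseGas
open Summit.AtomisticToContinuum.BoseEinsteinCondensation.Theorems.SwapToZeroMode

/-- **The Mayers junction: `SingleParticleInfluence → ConditionalAmplitudeAlignment → SomeNearMinimiserCondenses`.**
See the module docstring for the two hypotheses (spelled out; the planner may file them verbatim as items). Proof: for
small `ρ` and large `N` pick ground states `Θ₀` (existence, `eventually_exists_groundStates_succBox`) and `Ψ₀` with
single-particle influence `≤ c₀/16` (`hSI`), and the aligned mode `u` with its test weight (`hAL`); the intrinsic Mayers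
bound `occupation_ge_alignment_sub_leastSquares` gives `occ(u, Ψ₀)^{1/2} ≥ √(N+1)(√(15c₀/16) − √(c₀)/4) ≥ √(N+1)√c₀/2`; a
near-minimising trial state `Φ` within `√(c₀)/4` of `Ψ₀` in `L²` at any slack (`stub_groundStateApprox`) keeps
`occ(u, Φ)^{1/2} ≥ √(N+1)√c₀/4` (`occupation_rpow_half_le_add`), so `λ_max(γ_Φ) ≥ (c₀/16)(N+1)`.
[cite: Mayers2001, Eq. (1)–(3)] [cite: PenroseOnsager1956] -/
theorem someNearMinimiserCondenses_of_singleInfluence_of_alignment :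
    (∀ v : ℝ → ℝ≥0∞, IsRepulsiveFiniteRange v →
      ∃ ρ₀ : ℝ, 0 < ρ₀ ∧ ∀ ρ : ℝ, 0 < ρ → ρ < ρ₀ → ∀ ε : ℝ, 0 < ε → ∀ᶠ N : ℕ in atTop,
        ∀ Θ₀ : Config N → ℂ, IsGroundState v (sideLength ρ (N + 1)) Θ₀ →
          ∃ Ψ₀ : Config (N + 1) → ℂ, IsGroundState v (sideLength ρ (N + 1)) Ψ₀ ∧
            ∀ i : Fin N, (∫⁻ Z in boxN (N + 1) (sideLength ρ (N + 1)),
              (‖Ψ₀ Z -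
                ((∫ x in box (sideLength ρ (N + 1)), conj (Θ₀ (Matrix.vecTail (Function.update Z (Fin.succ i) x))) *
                  Ψ₀ (Function.update Z (Fin.succ i) x)) /
                (((∫⁻ x in box (sideLength ρ (N + 1)),
                    (‖Θ₀ (Matrix.vecTail (Function.update Z (Fin.succ i) x))‖₊ : ℝ≥0∞) ^ 2).toReal : ℝ) : ℂ)) *
                  Θ₀ (Matrix.vecTail Z)‖₊ : ℝ≥0∞) ^ 2) ≤ ENNReal.ofReal ε) →
    (∀ v : ℝ → ℝ≥0∞, IsRepulsiveFiniteRange v →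
      ∃ ρ₀ : ℝ, 0 < ρ₀ ∧ ∃ c₀ : ℝ, 0 < c₀ ∧ ∀ ρ : ℝ, 0 < ρ → ρ < ρ₀ → ∀ᶠ N : ℕ in atTop,
        ∀ (Θ₀ : Config N → ℂ) (Ψ₀ : Config (N + 1) → ℂ), IsGroundState v (sideLength ρ (N + 1)) Θ₀ →
          IsGroundState v (sideLength ρ (N + 1)) Ψ₀ →
          ∃ (i : Fin N) (u : Space → ℂ) (κ : Config N → ℝ≥0∞), AEStronglyMeasurable u volume ∧
            (∫⁻ x, (‖u x‖₊ : ℝ≥0∞) ^ 2 = 1) ∧ Measurable κ ∧ (∀ X, κ X ≤ 1) ∧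
            (∀ X, κ X * ∫⁻ a in box (sideLength ρ (N + 1)), (‖Θ₀ (Function.update X i a)‖₊ : ℝ≥0∞) ^ 2 ≤
              (‖∫ a in box (sideLength ρ (N + 1)), conj (u a) * Θ₀ (Function.update X i a)‖₊ : ℝ≥0∞) ^ 2) ∧
            ENNReal.ofReal c₀ ≤ ∫⁻ Z in boxN (N + 1) (sideLength ρ (N + 1)),
              (‖Ψ₀ Z‖₊ : ℝ≥0∞) ^ 2 * κ (Matrix.vecTail Z)) →
    Summit.AtomisticToContinuum.BoseEinsteinCondensation.Theses.BECHeatBathGap.SomeNearMinimiserCondenses := by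
  intro hSI hAL v hv
  -- two `ℝ≥0∞` square-root facts (also in the tree as `ENNReal.rpow_half_sq`, `ennreal_ofReal_rpow_half`)
  have rpow_half_sq : ∀ x : ℝ≥0∞, (x ^ (1 / 2 : ℝ)) ^ 2 = x := fun x => by
    rw [← ENNReal.rpow_natCast, ← ENNReal.rpow_mul]
    norm_num
  have ofReal_rpow_half : ∀ {r : ℝ}, 0 ≤ r → ENNReal.ofReal r ^ (1 / 2 : ℝ) = ENNReal.ofReal (Real.sqrt r) :=
    fun hr => by rw [ENNReal.ofReal_rpow_of_nonneg hr (by norm_num), Real.sqrt_eq_rpow]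
  obtain ⟨ρ₂, hρ₂, c₀, hc₀, H2⟩ := hAL v hv
  obtain ⟨ρ₁, hρ₁, H1⟩ := hSI v hv
  obtain ⟨ρ₃, hρ₃, H3⟩ := eventually_exists_groundStates_succBox v hv
  refine ⟨min ρ₁ (min ρ₂ ρ₃), lt_min hρ₁ (lt_min hρ₂ hρ₃), fun ρ hρ hρlt => ?_⟩
  have hρ1 : ρ < ρ₁ := hρlt.trans_le (min_le_left _ _)
  have hρ2 : ρ < ρ₂ := hρlt.trans_le ((min_le_right _ _).trans (min_le_left _ _))
  have hρ3 : ρ < ρ₃ := hρlt.trans_le ((min_le_right _ _).trans (min_le_right _ _))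
  -- the constants: `t = √c₀`, tolerance `ε = η = t²/16 = c₀/16`, output `c = c₀/16`
  set t : ℝ := Real.sqrt c₀ with ht
  have htpos : 0 < t := Real.sqrt_pos.2 hc₀
  have hct : c₀ = t ^ 2 := (Real.sq_sqrt hc₀.le).symm
  set ε : ℝ := t ^ 2 / 16 with hε
  have hεpos : 0 < ε := by positivity
  refine ⟨c₀ / 16, by positivity, ?_⟩
  filter_upwards [H1 ρ hρ hρ1 ε hεpos, H2 ρ hρ hρ2, H3 ρ hρ hρ3] with N hN1 hN2 hN3 δ hδ
  set L := sideLength ρ (N + 1) with hL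
  -- ground states and the aligned mode
  obtain ⟨⟨Θ₀, hΘ₀⟩, -⟩ := hN3
  obtain ⟨Ψ₀, hΨ₀, hLS⟩ := hN1 Θ₀ hΘ₀
  obtain ⟨i, u, κ, hu, hu1, hκm, hκ1, hκ, hal⟩ := hN2 Θ₀ Ψ₀ hΘ₀ hΨ₀
  -- square integrability on the boxes (ground states are normalised on the whole space)
  have hsq : ∀ {n : ℕ} {Φ : Config n → ℂ}, IsGroundState v L Φ →
      ∫⁻ X in boxN n L, (‖Φ X‖₊ : ℝ≥0∞) ^ 2 ≠ ⊤ := fun hΦ =>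
    ne_top_of_le_ne_top (by rw [hΦ.norm_eq]; exact ENNReal.one_ne_top) (setLIntegral_le_lintegral _ _)
  -- the intrinsic Mayers bound for `Ψ₀`
  have hM := occupation_ge_alignment_sub_leastSquares N L Θ₀ Ψ₀ hΘ₀.measurable hΨ₀.measurable hΘ₀.eq_zero
    hΨ₀.eq_zero (hsq hΘ₀) (hsq hΨ₀) i (fun Z => hΨ₀.symm _ Z) u κ hu hu1 hκm hκ1 hκ
  set s : ℝ≥0∞ := ((N + 1 : ℕ) : ℝ≥0∞) ^ (1 / 2 : ℝ) with hs
  have hsfin : s ≠ ⊤ := ENNReal.rpow_ne_top_of_nonneg (by norm_num) (ENNReal.natCast_ne_top _)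
  have hs2 : s ^ 2 = ((N + 1 : ℕ) : ℝ≥0∞) := rpow_half_sq _
  set D : ℝ≥0∞ := ∫⁻ Z in boxN (N + 1) L, (‖Ψ₀ Z -
      ((∫ x in box L, conj (Θ₀ (Matrix.vecTail (Function.update Z (Fin.succ i) x))) *
          Ψ₀ (Function.update Z (Fin.succ i) x)) /
        (((∫⁻ x in box L, (‖Θ₀ (Matrix.vecTail (Function.update Z (Fin.succ i) x))‖₊ : ℝ≥0∞) ^ 2).toReal
          : ℝ) : ℂ)) *
        Θ₀ (Matrix.vecTail Z)‖₊ : ℝ≥0∞) ^ 2 with hD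
  set AL : ℝ≥0∞ := ∫⁻ Z in boxN (N + 1) L, (‖Ψ₀ Z‖₊ : ℝ≥0∞) ^ 2 * κ (Matrix.vecTail Z) with hAL
  change s * (AL - D) ^ (1 / 2 : ℝ) ≤ occupation (N + 1) u Ψ₀ ^ (1 / 2 : ℝ) + s * D ^ (1 / 2 : ℝ) at hM
  have hDle : D ≤ ENNReal.ofReal ε := hLS i
  have hALge : ENNReal.ofReal c₀ ≤ AL := hal
  -- real bookkeeping of the constants
  have hsqε : Real.sqrt ε = t / 4 := by
    rw [hε, show t ^ 2 / 16 = (t / 4) ^ 2 by ring]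
    exact Real.sqrt_sq (by positivity)
  have hsq1 : 3 * t / 4 ≤ Real.sqrt (c₀ - ε) := by
    refine (Real.le_sqrt (by positivity) (by rw [hct, hε]; nlinarith [sq_nonneg t])).2 ?_
    rw [hct, hε]
    nlinarith [sq_nonneg t]
  set r₁ : ℝ := Real.sqrt (c₀ - ε) - Real.sqrt ε with hr₁
  have hr₁ge : t / 2 ≤ r₁ := by rw [hr₁, hsqε]; linarith
  have hr₁pos : 0 ≤ r₁ := le_trans (by positivity) hr₁ge
  set r₂ : ℝ := r₁ - Real.sqrt ε with hr₂
  have hr₂ge : t / 4 ≤ r₂ := by rw [hr₂, hsqε]; linarith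
  have hr₂pos : 0 ≤ r₂ := le_trans (by positivity) hr₂ge
  have hr₂sq : c₀ / 16 ≤ r₂ ^ 2 := by
    rw [hct]
    nlinarith [hr₂ge, htpos]
  have hεle : ε ≤ c₀ := by rw [hct, hε]; nlinarith [sq_nonneg t]
  -- Step 1: `occ(u, Ψ₀)^{1/2} ≥ s · r₁`
  have hocc0 : s * ENNReal.ofReal r₁ ≤ occupation (N + 1) u Ψ₀ ^ (1 / 2 : ℝ) := by
    -- lower bound for the left-hand side of the Mayers bound
    have hlow : s * ENNReal.ofReal (Real.sqrt (c₀ - ε)) ≤ s * (AL - D) ^ (1 / 2 : ℝ) := by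
      gcongr
      rw [← ofReal_rpow_half (by linarith)]
      gcongr
      rw [ENNReal.ofReal_sub _ hεpos.le]
      exact tsub_le_tsub hALge hDle
    -- upper bound for the error term
    have hup : s * D ^ (1 / 2 : ℝ) ≤ s * ENNReal.ofReal (Real.sqrt ε) := by
      gcongr
      rw [← ofReal_rpow_half hεpos.le]
      gcongr
    have h := (hlow.trans hM).trans (add_le_add_right hup _)
    -- `s √(c₀ − ε) ≤ occ^{1/2} + s √ε` ⇒ `s r₁ ≤ occ^{1/2}`
    have hsplit : s * ENNReal.ofReal r₁ = s * ENNReal.ofReal (Real.sqrt (c₀ - ε)) - s * ENNReal.ofReal (Real.sqrt ε) := by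
      rw [hr₁, ENNReal.ofReal_sub _ (Real.sqrt_nonneg _), ENNReal.mul_sub (fun _ _ => hsfin)]
    rw [hsplit]
    exact tsub_le_iff_right.2 h
  -- Step 2: a near-minimising trial state close to `Ψ₀`
  have hη : (0 : ℝ) < ε := hεpos
  obtain ⟨Φ, hΦE, hΦclose⟩ := stub_groundStateApprox (N + 1) L v Ψ₀ hΨ₀ δ hδ ε hη
  refine ⟨Φ, hΦE, ?_⟩
  -- Step 3: `occ(u, Φ)^{1/2} ≥ s · r₂`
  have hΦm : Measurable Φ.ψ := Φ.contDiff.continuous.measurable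
  have hlip := occupation_rpow_half_le_add hu hu1 hΨ₀.measurable hΦm (c := 1) (by simp)
  simp only [one_mul] at hlip
  have hdist : (∫⁻ X, (‖Ψ₀ X - Φ.ψ X‖₊ : ℝ≥0∞) ^ 2) ^ (1 / 2 : ℝ) ≤ ENNReal.ofReal (Real.sqrt ε) := by
    rw [← ofReal_rpow_half hεpos.le]
    gcongr
    calc ∫⁻ X, (‖Ψ₀ X - Φ.ψ X‖₊ : ℝ≥0∞) ^ 2 = ∫⁻ X, (‖Φ.ψ X - Ψ₀ X‖₊ : ℝ≥0∞) ^ 2 := by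
          refine lintegral_congr fun X => ?_
          rw [← nnnorm_neg, neg_sub]
      _ ≤ ENNReal.ofReal ε := hΦclose
  have hoccΦ : s * ENNReal.ofReal r₂ ≤ occupation (N + 1) u Φ.ψ ^ (1 / 2 : ℝ) := by
    have h := hocc0.trans (hlip.trans (add_le_add_right (mul_le_mul_right hdist _) _))
    have hsplit : s * ENNReal.ofReal r₂ = s * ENNReal.ofReal r₁ - s * ENNReal.ofReal (Real.sqrt ε) := by
      rw [hr₂, ENNReal.ofReal_sub _ (Real.sqrt_nonneg _), ENNReal.mul_sub (fun _ _ => hsfin)]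
    rw [hsplit]
    exact tsub_le_iff_right.2 h
  -- Step 4: square and compare with `λ_max`
  have hsqb : (s * ENNReal.ofReal r₂) ^ 2 ≤ occupation (N + 1) u Φ.ψ := by
    calc (s * ENNReal.ofReal r₂) ^ 2 ≤ (occupation (N + 1) u Φ.ψ ^ (1 / 2 : ℝ)) ^ 2 :=
          pow_le_pow_left₀ bot_le hoccΦ 2
      _ = occupation (N + 1) u Φ.ψ := rpow_half_sq _
  calc ENNReal.ofReal (c₀ / 16 * ((N : ℝ) + 1))
      = ((N + 1 : ℕ) : ℝ≥0∞) * ENNReal.ofReal (c₀ / 16) := by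
        rw [mul_comm, ENNReal.ofReal_mul (by positivity), ← Nat.cast_succ, ENNReal.ofReal_natCast]
    _ ≤ ((N + 1 : ℕ) : ℝ≥0∞) * ENNReal.ofReal (r₂ ^ 2) := by gcongr
    _ = (s * ENNReal.ofReal r₂) ^ 2 := by
        rw [mul_pow, hs2, ← ENNReal.ofReal_pow hr₂pos]
    _ ≤ occupation (N + 1) u Φ.ψ := hsqb
    _ ≤ maxOccupation (N + 1) Φ.ψ := occupation_le_maxOccupation _ hu hu1

end Summit.AtomisticToContinuum.BoseEinsteinCondensation.Theorems.SquareSummableInfluence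

end
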